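import Mathlib
import HarnessLib
import Literature.Analysis.FluidPDE.CollisionWeakForm
import Summits.AtomisticToContinuum.HydrodynamicLimit.Theses.JParityClosure

/-!
# Route JParityClosure — `ParitySplit` (item stmt-AtomisticToContinuum-13083)

The H-split in event form (CIP 1994 §3.2 micro-reversibility; Villani 2002 Ch. 1 §1.4, §2.4).
For a contact kernel `K(v, v_*, ω)`, a positive one-particle density `h` and the surprisal jump
`F = log (h h_* / (h' h_*'))`, write `K = K_s + K_a` with `K_s`, `K_a` the even / odd parts of
`K` under the inverse collision `J : (v, v_*, ω) ↦ (v', v_*', -ω)`. Since `J = T₂ ∘ T₁` with the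
two measure-preserving involutions `T₁ : (v, v_*, ω) ↦ (v_*', v', ω)` and
`T₂ : (v, v_*, ω) ↦ (v_*, v, -ω)` of `Literature.Analysis.FluidPDE.CollisionWeakForm`, `J`
preserves `dv dv_* dω`; under `J` the weights `h h_*` and `h' h_*'` are exchanged and `F ↦ -F`.
Pointwise `h h_* F (1 - e^{-F}) = (h h_* - h' h_*') F` and
`h h_* F (1 + e^{-F}) = (h h_* + h' h_*') F`, and `J`-symmetrisation of an integrable function
does not change its integral; this gives the two event identities
`∫ K h h_* F (1 - e^{-F}) = ∫ K_s (h h_* - h' h_*') F = 4 · entropyProduction K_s h` and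
`∫ K h h_* F (1 + e^{-F}) = ∫ K_a (h h_* + h' h_*') F`.

Main result: `paritySplit_proof : …Theses.JParityClosure.ParitySplit`. The helper lemmas are
stated for a general finite-dimensional real inner product space `E` (the route decl is the case
`E = V3 = EuclideanSpace ℝ (Fin 3)`). The measurability hypothesis of the route decl is not
needed.
-/

open MeasureTheory Metric Real

namespace Summit.AtomisticToContinuum.HydrodynamicLimit.Theorems

open Literature.MathematicalPhysics.KineticTheory (collide sphereMeasure collide_collide)
open Literature.Analysis.FluidPDE (collide_neg_dir integral_comp_swap_negDir
  integral_comp_collideSwap_prod integrable_comp_swap_negDir_iff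
  integrable_comp_collideSwap_prod_iff entropyProduction)

section General

variable {E : Type*} [NormedAddCommGroup E] [InnerProductSpace ℝ E]

/-- The inverse collision undoes the collision: `collide (-ω) (collide ω p) = p`
(so `J : (p, ω) ↦ (collide ω p, -ω)` is an involution). -/
theorem paritySplit_collide_negDir_collide (ω : sphere (0 : E) 1) (p : E × E) :
    collide (-ω) (collide ω p) = p := by
  rw [collide_neg_dir, collide_collide]

/-- For `a, b > 0` and `L = log (a / b)`: `a · (L · (1 - e^{-L})) = (a - b) · L`. -/
theorem paritySplit_mul_log_mul_one_sub_exp {a b : ℝ} (ha : 0 < a) (hb : 0 < b) :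
    a * (Real.log (a / b) * (1 - Real.exp (-Real.log (a / b)))) = (a - b) * Real.log (a / b) := by
  rw [Real.exp_neg, Real.exp_log (div_pos ha hb), inv_div]
  have ha' : a ≠ 0 := ha.ne'
  field_simp

/-- For `a, b > 0` and `L = log (a / b)`: `a · (L · (1 + e^{-L})) = (a + b) · L`. -/
theorem paritySplit_mul_log_mul_one_add_exp {a b : ℝ} (ha : 0 < a) (hb : 0 < b) :
    a * (Real.log (a / b) * (1 + Real.exp (-Real.log (a / b)))) = (a + b) * Real.log (a / b) := by
  rw [Real.exp_neg, Real.exp_log (div_pos ha hb), inv_div]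
  have ha' : a ≠ 0 := ha.ne'
  field_simp

/-- `log (b / a) = -log (a / b)` (no positivity needed, by `Real.log_inv`). -/
theorem paritySplit_log_div_swap (a b : ℝ) : Real.log (b / a) = -Real.log (a / b) := by
  rw [← inv_div, Real.log_inv]

variable [FiniteDimensional ℝ E] [MeasurableSpace E] [BorelSpace E]

/-- **Change of variables under the inverse collision** `J : (v, v_*, ω) ↦ (v', v_*', -ω)` in
integrals over `E × E × S^{d-1}`: `J = T₂ ∘ T₁` with `T₁ : (v, v_*, ω) ↦ (v_*', v', ω)` and
`T₂ : (v, v_*, ω) ↦ (v_*, v, -ω)`, both measure-preserving (CIP 1994 §3.1 p. 35, unit Jacobian). -/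
theorem paritySplit_integral_comp_J {F : Type*} [NormedAddCommGroup F] [NormedSpace ℝ F]
    (G : (E × E) × sphere (0 : E) 1 → F) :
    ∫ q, G (collide q.2 q.1, -q.2) ∂(((volume : Measure E).prod volume).prod sphereMeasure) =
      ∫ q, G q ∂(((volume : Measure E).prod volume).prod sphereMeasure) := by
  have h1 :
      ∫ q, G (collide q.2 q.1, -q.2) ∂(((volume : Measure E).prod volume).prod sphereMeasure) =
        ∫ q, G (q.1.swap, -q.2) ∂(((volume : Measure E).prod volume).prod sphereMeasure) := by
    simpa only [Prod.swap_swap] using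
      integral_comp_collideSwap_prod (E := E) (fun q => G (q.1.swap, -q.2))
  rw [h1]
  exact integral_comp_swap_negDir G

/-- Integrability is invariant under the inverse collision `J : (v, v_*, ω) ↦ (v', v_*', -ω)`. -/
theorem paritySplit_integrable_comp_J_iff {F : Type*} [NormedAddCommGroup F]
    (G : (E × E) × sphere (0 : E) 1 → F) :
    Integrable (fun q => G (collide q.2 q.1, -q.2))
        (((volume : Measure E).prod volume).prod sphereMeasure) ↔
      Integrable G (((volume : Measure E).prod volume).prod sphereMeasure) := by
  have h1 : Integrable (fun q => G (collide q.2 q.1, -q.2))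
        (((volume : Measure E).prod volume).prod sphereMeasure) ↔
      Integrable (fun q => G (q.1.swap, -q.2))
        (((volume : Measure E).prod volume).prod sphereMeasure) := by
    simpa only [Prod.swap_swap] using
      integrable_comp_collideSwap_prod_iff (E := E) (fun q => G (q.1.swap, -q.2))
  rw [h1]
  exact integrable_comp_swap_negDir_iff G

/-- `J`-symmetrisation does not change the integral of an integrable function:
`∫ (G + G ∘ J) / 2 = ∫ G`. -/
theorem paritySplit_integral_symmetrise (G : (E × E) × sphere (0 : E) 1 → ℝ)
    (hG : Integrable G (((volume : Measure E).prod volume).prod sphereMeasure)) :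
    ∫ q, (G q + G (collide q.2 q.1, -q.2)) / 2
        ∂(((volume : Measure E).prod volume).prod sphereMeasure) =
      ∫ q, G q ∂(((volume : Measure E).prod volume).prod sphereMeasure) := by
  have hGJ : Integrable (fun q => G (collide q.2 q.1, -q.2))
      (((volume : Measure E).prod volume).prod sphereMeasure) :=
    (paritySplit_integrable_comp_J_iff G).2 hG
  rw [integral_div, integral_add hG hGJ, paritySplit_integral_comp_J G]
  ring

/-- **H-split, even part** (CIP 1994 §3.2; Villani 2002 Ch. 1 §2.4): for `h > 0`,
`F = log (h h_* / (h' h_*'))` and `K_s = (K + K ∘ J) / 2`,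
`∫ K h h_* F (1 - e^{-F}) = ∫ K_s (h h_* - h' h_*') F`, under integrability of `K h h_* F` and
`K h' h_*' F`. -/
theorem paritySplit_even (K : E × E → sphere (0 : E) 1 → ℝ) (h : E → ℝ) (hpos : ∀ v, 0 < h v)
    (hI1 : Integrable (fun q : (E × E) × sphere (0 : E) 1 => K q.1 q.2 * (h q.1.1 * h q.1.2) *
      Real.log (h q.1.1 * h q.1.2 / (h (collide q.2 q.1).1 * h (collide q.2 q.1).2)))
      (((volume : Measure E).prod volume).prod sphereMeasure))
    (hI2 : Integrable (fun q : (E × E) × sphere (0 : E) 1 => K q.1 q.2 *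
      (h (collide q.2 q.1).1 * h (collide q.2 q.1).2) *
      Real.log (h q.1.1 * h q.1.2 / (h (collide q.2 q.1).1 * h (collide q.2 q.1).2)))
      (((volume : Measure E).prod volume).prod sphereMeasure)) :
    ∫ q, K q.1 q.2 * (h q.1.1 * h q.1.2) *
        (Real.log (h q.1.1 * h q.1.2 / (h (collide q.2 q.1).1 * h (collide q.2 q.1).2)) *
          (1 - Real.exp (-Real.log (h q.1.1 * h q.1.2 /
            (h (collide q.2 q.1).1 * h (collide q.2 q.1).2)))))
        ∂(((volume : Measure E).prod volume).prod sphereMeasure) =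
      ∫ q, (K q.1 q.2 + K (collide q.2 q.1) (-q.2)) / 2 *
        (h q.1.1 * h q.1.2 - h (collide q.2 q.1).1 * h (collide q.2 q.1).2) *
        Real.log (h q.1.1 * h q.1.2 / (h (collide q.2 q.1).1 * h (collide q.2 q.1).2))
        ∂(((volume : Measure E).prod volume).prod sphereMeasure) := by
  -- the common value is `∫ G` with `G = K (h h_* - h' h_*') F`
  let G : (E × E) × sphere (0 : E) 1 → ℝ := fun q => K q.1 q.2 *
    (h q.1.1 * h q.1.2 - h (collide q.2 q.1).1 * h (collide q.2 q.1).2) *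
    Real.log (h q.1.1 * h q.1.2 / (h (collide q.2 q.1).1 * h (collide q.2 q.1).2))
  have hG : Integrable G (((volume : Measure E).prod volume).prod sphereMeasure) := by
    refine (hI1.sub hI2).congr (ae_of_all _ fun q => ?_)
    simp only [G, Pi.sub_apply]
    ring
  calc _ = ∫ q, G q ∂(((volume : Measure E).prod volume).prod sphereMeasure) := by
        refine integral_congr_ae (ae_of_all _ fun q => ?_)
        have ha : 0 < h q.1.1 * h q.1.2 := mul_pos (hpos _) (hpos _)
        have hb : 0 < h (collide q.2 q.1).1 * h (collide q.2 q.1).2 := mul_pos (hpos _) (hpos _)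
        simp only [G]
        rw [mul_assoc (K q.1 q.2), paritySplit_mul_log_mul_one_sub_exp ha hb, ← mul_assoc]
    _ = ∫ q, (G q + G (collide q.2 q.1, -q.2)) / 2
          ∂(((volume : Measure E).prod volume).prod sphereMeasure) :=
        (paritySplit_integral_symmetrise G hG).symm
    _ = _ := by
        refine integral_congr_ae (ae_of_all _ fun q => ?_)
        simp only [G, paritySplit_collide_negDir_collide]
        rw [paritySplit_log_div_swap (h q.1.1 * h q.1.2)]
        ring

/-- **H-split, odd part**: for `h > 0`, `F = log (h h_* / (h' h_*'))` and `K_a = (K - K ∘ J) / 2`,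
`∫ K h h_* F (1 + e^{-F}) = ∫ K_a (h h_* + h' h_*') F`, under integrability of `K h h_* F` and
`K h' h_*' F`. -/
theorem paritySplit_odd (K : E × E → sphere (0 : E) 1 → ℝ) (h : E → ℝ) (hpos : ∀ v, 0 < h v)
    (hI1 : Integrable (fun q : (E × E) × sphere (0 : E) 1 => K q.1 q.2 * (h q.1.1 * h q.1.2) *
      Real.log (h q.1.1 * h q.1.2 / (h (collide q.2 q.1).1 * h (collide q.2 q.1).2)))
      (((volume : Measure E).prod volume).prod sphereMeasure))
    (hI2 : Integrable (fun q : (E × E) × sphere (0 : E) 1 => K q.1 q.2 *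
      (h (collide q.2 q.1).1 * h (collide q.2 q.1).2) *
      Real.log (h q.1.1 * h q.1.2 / (h (collide q.2 q.1).1 * h (collide q.2 q.1).2)))
      (((volume : Measure E).prod volume).prod sphereMeasure)) :
    ∫ q, K q.1 q.2 * (h q.1.1 * h q.1.2) *
        (Real.log (h q.1.1 * h q.1.2 / (h (collide q.2 q.1).1 * h (collide q.2 q.1).2)) *
          (1 + Real.exp (-Real.log (h q.1.1 * h q.1.2 /
            (h (collide q.2 q.1).1 * h (collide q.2 q.1).2)))))
        ∂(((volume : Measure E).prod volume).prod sphereMeasure) =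
      ∫ q, (K q.1 q.2 - K (collide q.2 q.1) (-q.2)) / 2 *
        (h q.1.1 * h q.1.2 + h (collide q.2 q.1).1 * h (collide q.2 q.1).2) *
        Real.log (h q.1.1 * h q.1.2 / (h (collide q.2 q.1).1 * h (collide q.2 q.1).2))
        ∂(((volume : Measure E).prod volume).prod sphereMeasure) := by
  -- the common value is `∫ G` with `G = K (h h_* + h' h_*') F`, which is `J`-odd up to `K ↦ K ∘ J`
  let G : (E × E) × sphere (0 : E) 1 → ℝ := fun q => K q.1 q.2 *
    (h q.1.1 * h q.1.2 + h (collide q.2 q.1).1 * h (collide q.2 q.1).2) *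
    Real.log (h q.1.1 * h q.1.2 / (h (collide q.2 q.1).1 * h (collide q.2 q.1).2))
  have hG : Integrable G (((volume : Measure E).prod volume).prod sphereMeasure) := by
    refine (hI1.add hI2).congr (ae_of_all _ fun q => ?_)
    simp only [G, Pi.add_apply]
    ring
  calc _ = ∫ q, G q ∂(((volume : Measure E).prod volume).prod sphereMeasure) := by
        refine integral_congr_ae (ae_of_all _ fun q => ?_)
        have ha : 0 < h q.1.1 * h q.1.2 := mul_pos (hpos _) (hpos _)
        have hb : 0 < h (collide q.2 q.1).1 * h (collide q.2 q.1).2 := mul_pos (hpos _) (hpos _)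
        simp only [G]
        rw [mul_assoc (K q.1 q.2), paritySplit_mul_log_mul_one_add_exp ha hb, ← mul_assoc]
    _ = ∫ q, (G q + G (collide q.2 q.1, -q.2)) / 2
          ∂(((volume : Measure E).prod volume).prod sphereMeasure) :=
        (paritySplit_integral_symmetrise G hG).symm
    _ = _ := by
        refine integral_congr_ae (ae_of_all _ fun q => ?_)
        simp only [G, paritySplit_collide_negDir_collide]
        rw [paritySplit_log_div_swap (h q.1.1 * h q.1.2)]
        ring

/-- **The even part is the entropy production**: with `K_s = (K + K ∘ J) / 2`,
`∫ K_s (h h_* - h' h_*') F = 4 · entropyProduction K_s h` (the tree's `entropyProduction` carries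
the factor `¼` and the integrand `(h' h_*' - h h_*) log (h' h_*' / (h h_*))`, equal pointwise to
`(h h_* - h' h_*') F`). No positivity or integrability is needed. -/
theorem paritySplit_entropy (K : E × E → sphere (0 : E) 1 → ℝ) (h : E → ℝ) :
    ∫ q, (K q.1 q.2 + K (collide q.2 q.1) (-q.2)) / 2 *
        (h q.1.1 * h q.1.2 - h (collide q.2 q.1).1 * h (collide q.2 q.1).2) *
        Real.log (h q.1.1 * h q.1.2 / (h (collide q.2 q.1).1 * h (collide q.2 q.1).2))
        ∂(((volume : Measure E).prod volume).prod sphereMeasure) =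
      4 * entropyProduction (fun p ω => (K p ω + K (collide ω p) (-ω)) / 2) h := by
  simp only [entropyProduction]
  rw [← mul_assoc, mul_inv_cancel₀ (four_ne_zero : (4 : ℝ) ≠ 0), one_mul]
  refine integral_congr_ae (ae_of_all _ fun q => ?_)
  dsimp only
  rw [paritySplit_log_div_swap (h q.1.1 * h q.1.2)]
  ring

end General

/-- **`ParitySplit` holds** (item stmt-AtomisticToContinuum-13083 of route JParityClosure): the
H-split in event form on `V3 × V3 × S²`, assembled from `paritySplit_even`, `paritySplit_odd` and
`paritySplit_entropy`. The measurability hypothesis of the route decl is not used. -/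
theorem paritySplit_proof :
    Summit.AtomisticToContinuum.HydrodynamicLimit.Theses.JParityClosure.ParitySplit := by
  unfold Summit.AtomisticToContinuum.HydrodynamicLimit.Theses.JParityClosure.ParitySplit
  intro K h _ hpos
  dsimp only
  intro hI1 hI2
  exact ⟨paritySplit_even K h hpos hI1 hI2, paritySplit_odd K h hpos hI1 hI2,
    paritySplit_entropy K h⟩

end Summit.AtomisticToContinuum.HydrodynamicLimit.Theorems
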